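import Literature.MathematicalPhysics.QuantumFieldTheory.Balaban1983to89.B13GreenSymLettersOfReg335
import Literature.MathematicalPhysics.QuantumFieldTheory.Balaban1983to89.B13XinvSymLettersOfReg335

/-!
# `Balaban1983to89.B13GreenSymLettersOfReg335Closed` — T. Bałaban, *Propagators for lattice gauge theories in a background field*, Commun. Math. Phys. **99** (1985)
# 389–434 [Balaban1985BackgroundPropagators], (3.19)–(3.27) pp. 393–395, (3.35) p. 396, Thms 3.1–3.3 pp. 397–399, Thm 3.4 p. 400, (3.84)–(3.86) p. 407, Thm 3.10
# (3.107)–(3.108) pp. 415–416, Thm 3.11 p. 416; [Balaban1984PropagatorsII] p. 226, Prop 2.3 p. 238; [Balaban1988RG2Cluster] (2.5)–(2.7) pp. 12–13, p. 15: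
# ★★★★ PRINT's CHAIN `G′ → (Q′G′²Q′*)⁻¹ → R → Δ_a → G` ON THE (3.35) CLASS WITH THE X⁻¹ LETTERS DISCHARGED — THE ONLY ANALYTIC INPUT LEFT IS ROW 17's ONE CLAUSE

statement-level composition of cited tree theorems; kernel-checked; THEOREMS ONLY; nothing of NODE 00's ∕ N06's is modified; nothing here is a claim about the
Yang–Mills mass gap; no node is discharged; count-neutral.

WHY THIS FILE (cell `pub-ymgap`, D-0062 ∕ D-0149 ∕ D-0154, Track A node N10 = [B13]; width seat `pub-ymgap-dag-n10-w5` g3, the «closed» sibling offered to dag-n10-w2 g3 on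
the bus (HOME INBOX l.≈31993) after its end-to-end capstone `B13GreenSymLettersOfReg335` (p617682)).  The capstone DISPLAYS two analytic inputs: (a) the X⁻¹-junction's
output `hXi` (Theorem 3.2's content) and (b) ROW 17's ONE CLAUSE `PosDefTr 1 (Δ_a(U₀))`.  Input (a) is a TREE THEOREM on the (3.35) class — this seat's
`B13XinvSymLettersOfReg335.rawEntryLetters_toMatrix_XinvY_parSymY_prodCfg_of_letters_located` fed with dag-n10-c's module-79 letters of `G′` (coercivity of `Q′G′²Q′*` =
n06-w1's `trIP_XY_parSymY_ge` through the lane's modules 80 ∕ 81 and `B13XinvCentreDecayOfReg335`; invertibility = dag-n06-j).  THIS FILE performs that `obtain`: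
* §1 ★★★★ `exists_rawEntryLetters_toMatrix_GAY_recordV4_prodCfg_of_reg335_of_posDefTr_one_closed` — for EVERY `U₀ ∈ (bg9K (M_N ℂ) G i).Reg335 c α₀` (`G ≤ U(N)`,
  `0 ≤ c·M·α₀`, `c·M·α₀·(d+1) ≤ 1∕16`), at `parSymY ∕ parBY ∕ GpY i (parSymY i)` and the record's matrix units, given ONLY NODE 00's dictionary numerals and readings
  (79's `D, Cavg, ℓ′, s, κr, m`; the X-station's `D_Q, CQ, CQs` and the R-station's `CQsr, CQc`, block reading `ℓB` with `r`, fibre `m_B`; 76's `c₁ c₂ N_b D_a c_Q c_{Q*} c_a`,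
  bond reading `ℓF` with `s_F`; the G-station's `CgR CdC r′`, fibre `m_F`), `η`, `0 < Rc`, a rate chain `0 ≤ ρ′ < δ₀κr`, `0 < μ₁ < ρ′`, `0 ≤ κ ≤ (ρ′−μ₁)∕4` with the ONE
  81-shape smallness of `κ` (the located Combes–Thomas window of the X⁻¹ step), `0 ≤ ρ_X < κ`, `0 < μ`, `2μ < ρ_X`, AND ROW 17's ONE CLAUSE
  `hpd : PosDefTr (fun _ => 1) (deltaAY i (parSymY i) (parBY i) (GpY i (parSymY i)) U₀)`:
  `∃ κ_G > 0, ∃ B_G ≥ 0, ∀ 0 ≤ ρ″ < κ_G, ∃ R₁ > 0, RawEntryLetters (A′ ↦ toMatrix B′ B′ (G(e^{iηA′}U₀))) (ℓF ∘ fst) R₁ ρ″ B_G`.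
HONEST FRAMING: a two-step composition (`obtain` the X⁻¹ letters, apply the capstone); (b) is the QUALITATIVE positivity of `Δ_a(U₀)` — Theorems 3.3 ∕ 3.11 ∕ [4] p. 226 for
def-Y's operator on the class — N06's open sentence at the record, NOT proved here; its coercivity constant is unlocated, hence the qualitative rate; print's multi-scale
rates `δ₀d(y,y′)` NOT claimed (rates per reading step, n06-w1's declared scope); which readings ∕ `η` ∕ `U₀` ∕ letter family are «of record» is NODE 00's ∕ def-Y's ∕ def-T's
word; nothing of Bałaban's asserted beyond the cited theorems; N06 ∕ N10 NOT discharged; K1⁷ NOT closed; counts unmoved (typed 28∕28 · discharged 5∕27); 0 `def`, 0 `sorry`,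
standard axioms; one finite 𝕋⁴ programme at fixed ε — R4 closes the conditional finite-𝕋⁴ rung `BalabanLadder.UV` only; the YM mass gap (Clay) is NOT proved by any of
this; nothing continuum ∕ ℝ⁴ ∕ OS.

References: T. Bałaban, CMP 99 (1985) 389–434 [Balaban1985BackgroundPropagators] (3.19)–(3.27) pp.393–395, (3.35) p.396, Thm 3.1 (3.42) p.397, Thm 3.2 (3.48) p.398,
Thm 3.3 p.399, Thm 3.4 p.400, (3.66)–(3.70) pp.403–404, (3.84)–(3.86) p.407, Thm 3.10 (3.107)–(3.108) pp.415–416, Thm 3.11 p.416; CMP 96 (1984) 223–250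
[Balaban1984PropagatorsII] p.226, Lemma 2.1 (2.61) p.234, Prop 2.3 p.238; CMP 116 (1988) 1–22 [Balaban1988RG2Cluster] (2.5)–(2.7) pp.12–13, p.15.
-/

noncomputable section

namespace Literature.MathematicalPhysics.QuantumFieldTheory.Balaban1983to89.B13GreenSymLettersOfReg335Closed

open Metric Set Finset Module
open scoped Matrix Matrix.Norms.L2Operator
open Literature.MathematicalPhysics.QuantumFieldTheory.Balaban1983to89
open Literature.MathematicalPhysics.QuantumFieldTheory.Balaban1983to89.B9Thm37GlueTorus (tdist1)
open Literature.MathematicalPhysics.QuantumFieldTheory.Balaban1983to89.B5TorusCover (UT)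
open Literature.MathematicalPhysics.QuantumFieldTheory.Balaban1983to89.B4TorusKernel.MultiPeriod (torusSupNorm)
open Literature.MathematicalPhysics.QuantumFieldTheory.Balaban1983to89.B9Thm311ReadingCoords (trIP PosDefTr)
open Literature.MathematicalPhysics.QuantumFieldTheory.Balaban1983to89.B13EntrywiseWalks (RawEntryLetters)
open Literature.MathematicalPhysics.QuantumFieldTheory.Balaban1983to89.B13InverseLettersNeumannRadius (thinRadius_pos thinRadius_le)
open Literature.MathematicalPhysics.QuantumFieldTheory.Balaban1983to89.B13GreenPrimeSymLettersOfReg335 (rawEntryLetters_toMatrix_GpY_parSymY_prodCfg_of_reg335_record)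
open Literature.MathematicalPhysics.QuantumFieldTheory.Balaban1983to89.B13XinvSymLettersOfReg335 (rawEntryLetters_toMatrix_XinvY_parSymY_prodCfg_of_letters_located)
open Literature.MathematicalPhysics.QuantumFieldTheory.Balaban1983to89.B13GreenSymLettersOfReg335 (exists_rawEntryLetters_toMatrix_GAY_recordV4_prodCfg_of_reg335_of_posDefTr_one)
open Literature.MathematicalPhysics.QuantumFieldTheory.Balaban1983to89.B15DeterminingSets (embIter)
open Literature.MathematicalPhysics.QuantumFieldTheory.Balaban1983to89.B9Eq39Adjoint (prodCfg)
open Literature.MathematicalPhysics.QuantumFieldTheory.Balaban1983to89.B6GlobalChartV1 (PV boxEquiv)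
open Literature.MathematicalPhysics.QuantumFieldTheory.Balaban1983to89.B6KLevelCensusIndexV1 (KIdx kGeo)
open Literature.MathematicalPhysics.QuantumFieldTheory.Balaban1983to89.B9BackgroundsKLevelV1 (bg9K)
open Literature.MathematicalPhysics.QuantumFieldTheory.Balaban1983to89.Node00

variable {d ℓ : ℕ} {hd : 1 ≤ d + 1} {hL : Odd (ℓ + 1) ∧ 1 < ℓ + 1} {b₀ b₁ : ℝ}
variable (i : KIdx d ℓ hd hL b₀ b₁) {N : ℕ} [NeZero N] {G : Subgroup (Matrix (Fin N) (Fin N) ℂ)ˣ}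
variable {ν : ℕ} {Nf : Fin ν → ℕ} [∀ j, NeZero (Nf j)]

/-! ## §1. ★★★★ The chain on the (3.35) class with X⁻¹'s letters discharged: ROW 17's one clause is the only analytic input -/

/-- ★★★★ **PRINT's CHAIN `G′ → (Q′G′²Q′*)⁻¹ → R → Δ_a → G` ON THE (3.35) CLASS, X⁻¹ DISCHARGED.**  For EVERY `U₀ ∈ (bg9K (M_N ℂ) G i).Reg335 c α₀` (`G ≤ U(N)`,
`0 ≤ c·M·α₀`, `c·M·α₀·(d+1) ≤ 1∕16`) at `parSymY ∕ parBY ∕ GpY i (parSymY i)`, matrix units: given NODE 00's dictionary numerals and readings, `η`, `0 < Rc`, the rate chain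
`0 ≤ ρ′ < δ₀κr`, `0 < μ₁ < ρ′`, `0 ≤ κ ≤ (ρ′−μ₁)∕4` with `8(Θ·a_X)κ(m_B·c₀(1,(ρ′−μ₁)∕2)^ν) ≤ (4(d+1)+1)⁻²(ρ′−μ₁)` (`Θ = √((L^k)^{d+1})`, `a_X` the X-station's located constant),
`0 ≤ ρ_X < κ`, `0 < μ`, `2μ < ρ_X`, and ROW 17's ONE CLAUSE `PosDefTr 1 (Δ_a(U₀))`: `∃ κ_G > 0, ∃ B_G ≥ 0, ∀ 0 ≤ ρ″ < κ_G, ∃ R₁ > 0, RawEntryLetters (A′ ↦ toMatrix B′ B′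
(G(e^{iηA′}U₀))) (ℓF ∘ fst) R₁ ρ″ B_G` — dag-n10-w2 g3's capstone `…_of_posDefTr_one` with its `hXi` := this seat's X⁻¹ knit at 79's located thin radius (G′ by module 79;
coercivity of `Q′G′²Q′*` by n06-w1, invertibility by dag-n06-j, Combes–Thomas by modules 80 ∕ 81).  The clause is the QUALITATIVE positivity (unlocated constant ⟹ qualitative
rate).  [cite: Balaban1985BackgroundPropagators, (3.19)–(3.27) pp.393–395, (3.35) p.396, Thm 3.1 (3.42) p.397, Thm 3.2 (3.48) p.398, Thm 3.3 p.399, Thm 3.4 p.400, (3.66)–(3.70)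
pp.403–404, (3.84)–(3.86) p.407, Thm 3.10 (3.107)–(3.108) pp.415–416, Thm 3.11 p.416; Balaban1984PropagatorsII, p.226, Lemma 2.1 (2.61) p.234, Prop 2.3 p.238;
Balaban1988RG2Cluster, (2.5)–(2.7) pp.12–13, p.15] -/
theorem exists_rawEntryLetters_toMatrix_GAY_recordV4_prodCfg_of_reg335_of_posDefTr_one_closed
    (hG : G ≤ B7Prop2Explicit.unitaryUnits (Matrix (Fin N) (Fin N) ℂ))
    {U₀ : CfgY (Matrix (Fin N) (Fin N) ℂ) i} {c α₀ : ℝ} (hC0 : 0 ≤ c * (kGeo i).M * α₀) (hC1 : c * (kGeo i).M * α₀ * ((d : ℝ) + 1) ≤ 1 / 16)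
    (hreg : (bg9K (Matrix (Fin N) (Fin N) ℂ) G i).Reg335 c α₀ U₀)
    (η : ℝ) {Rc : ℝ} (hRc : 0 < Rc)
    -- module 79's numerals for the G′ factor and its rate `ρ′`
    {D : ℕ}
    (hD : ∀ z w, avgCoeffY i z w ≠ 0 →
      Site.tdist ((boxEquiv i.hN).symm z) ((boxEquiv i.hN).symm (cornerY i (levY i z) z)) +
        Site.tdist ((boxEquiv i.hN).symm (cornerY i (levY i z) z)) ((boxEquiv i.hN).symm w) ≤ D)
    {Cavg : ℝ} (hCavg0 : 0 ≤ Cavg) (hCavg : ∀ z, ∑ w, |avgCoeffY i z w| ≤ Cavg)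
    (ℓ' : SiteY i → UT Nf) {s : ℝ} (hs0 : 0 ≤ s)
    (hℓ : ∀ μ z, tdist1 Nf (ℓ' (shiftY i μ z)) (ℓ' z) ≤ s) (hℓa : ∀ z w, avgCoeffY i z w ≠ 0 → tdist1 Nf (ℓ' z) (ℓ' w) ≤ s)
    {κr : ℝ} (hκ0 : 0 ≤ κr)
    (hκ : ∀ z w : SiteY i, κr * tdist1 Nf (ℓ' z) (ℓ' w) ≤ ((((ℓ + 1) ^ i.k : ℕ) : ℝ))⁻¹ * torusSupNorm (toKT i).NB (z.1 - w.1))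
    {m : ℕ} (hfib : ∀ y : UT Nf, (univ.filter fun p : SiteY i × (Fin N × Fin N) => ℓ' p.1 = y).card ≤ m)
    {ρ' : ℝ} (hρ'0 : 0 ≤ ρ') (hρ' : ρ' < (1 / (4 * ((d : ℝ) + 2))) * κr)
    -- the X- and R-stations' numerals (`Q′`-support `D_Q`, row ∕ column sums over `z` and over `s`, block reading `ℓB` with range `r`, fibre `m_B`)
    {DQ : ℕ}
    (hDQ : ∀ s z, qpK i s z ≠ 0 → Site.tdist ((boxEquiv i.hN).symm (blkCornerY i s)) ((boxEquiv i.hN).symm z) ≤ DQ)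
    (hDQs : ∀ z s, qpsK i z s ≠ 0 → Site.tdist ((boxEquiv i.hN).symm (blkCornerY i s)) ((boxEquiv i.hN).symm z) ≤ DQ)
    {CQ CQs : ℝ} (hCQ0 : 0 ≤ CQ) (hCQ : ∀ s, ∑ z, |qpK i s z| ≤ CQ) (hCQs0 : 0 ≤ CQs) (hCQs : ∀ s, ∑ z, |qpsK i z s| ≤ CQs)
    {CQsr CQc : ℝ} (hCQsr0 : 0 ≤ CQsr) (hCQsr : ∀ z, ∑ s, |qpsK i z s| ≤ CQsr) (hCQc0 : 0 ≤ CQc) (hCQc : ∀ z, ∑ s, |qpK i s z| ≤ CQc)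
    (ℓB : BlkY i → UT Nf) {r : ℝ}
    (hℓQ : ∀ s z, qpK i s z ≠ 0 → tdist1 Nf (ℓB s) (ℓ' z) ≤ r) (hℓQs : ∀ z s, qpsK i z s ≠ 0 → tdist1 Nf (ℓ' z) (ℓB s) ≤ r)
    {mB : ℕ} (hfibB : ∀ y : UT Nf, (univ.filter fun p : BlkY i × (Fin N × Fin N) => ℓB p.1 = y).card ≤ mB)
    -- the X⁻¹ step's rate chain: loss `μ₁`, the located Combes–Thomas rate `κ` with its ONE smallness, the X⁻¹ letters' rate `ρ_X`, the R-station's loss `μ`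
    {μ₁ : ℝ} (hμ₁ : 0 < μ₁) (hμ₁ρ : μ₁ < ρ')
    {κ : ℝ} (hκX0 : 0 ≤ κ) (hκ4 : κ ≤ (ρ' - μ₁) / 4)
    (hκm : 8 * (Real.sqrt ((((ℓ : ℝ) + 1) ^ i.k) ^ (d + 1)) *
        (CQ * (Fintype.card (Fin N × Fin N) : ℝ) * (1 * ((1 * Real.exp (|η| * Rc)) ^ DQ * 1 * (1 * Real.exp (|η| * Rc)) ^ DQ)) *
          (CQs * (Fintype.card (Fin N × Fin N) : ℝ) * (1 * ((1 * Real.exp (|η| * Rc)) ^ DQ * 1 * (1 * Real.exp (|η| * Rc)) ^ DQ))) *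
          ((2 * (1 * 1 * (16 * ((((ℓ + 1) ^ i.k : ℕ) : ℝ)) ^ 2 * Real.sqrt N))) * (2 * (1 * 1 * (16 * ((((ℓ + 1) ^ i.k : ℕ) : ℝ)) ^ 2 * Real.sqrt N))) *
            (m * B6.c0 1 μ₁ ^ ν)) * Real.exp (2 * (ρ' - μ₁) * r))) * κ * (mB * B6.c0 1 ((ρ' - μ₁) / 2) ^ ν) ≤
      ((4 * ((d : ℝ) + 1) + 1) ^ 2)⁻¹ * (ρ' - μ₁))
    {ρX : ℝ} (hρX0 : 0 ≤ ρX) (hρXκ : ρX < κ)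
    {μ : ℝ} (hμ : 0 < μ) (h2μ : 2 * μ < ρX)
    -- module 76's numerals for the local part `Δ(U) + Q*aQ(U)` and the bond reading `ℓF` with `s_F`
    {c₁ c₂ : ℝ} (hc₀ : 0 ≤ c₁) (hc₂0 : 0 ≤ c₂) (hc₁ : ∀ p, ∑ b, |curlK i p b| ≤ c₁) (hc₂ : ∀ b, ∑ p, |cocurlK i b p| ≤ c₂)
    {Nb : ℝ} (hNb0 : 0 ≤ Nb)
    (hNb : ∀ b : FBondY i,
      ((((Finset.univ : Finset (PlaqY i)) ×ˢ (Finset.univ : Finset (Fin 4))).filter fun pm => edgeY i pm.1 pm.2 = b).card : ℝ) ≤ Nb)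
    {Da : ℕ}
    (hDa : ∀ ι b, qK i ι b ≠ 0 → Site.tdist (embIter (ι.1.1 : ℕ) ι.1.2.src) b.src ≤ Da)
    (hDa' : ∀ b ι, qsK i b ι ≠ 0 → Site.tdist (embIter (ι.1.1 : ℕ) ι.1.2.src) b.src ≤ Da)
    {cQ cQs ca : ℝ} (hcQ0 : 0 ≤ cQ) (hcQs0 : 0 ≤ cQs) (hca0 : 0 ≤ ca) (hcQ : ∀ ι, ∑ b, |qK i ι b| ≤ cQ) (hcQs : ∀ b, ∑ ι, |qsK i b ι| ≤ cQs)
    (hca : ∀ ι, ∑ ι', |aK i ι ι'| ≤ ca)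
    (ℓF : FBondY i → UT Nf) {sF : ℝ}
    (hℓp : ∀ p m l, tdist1 Nf (ℓF (edgeY i p m)) (ℓF (edgeY i p l)) ≤ sF)
    (hℓq : ∀ b ι ι' b', qsK i b ι ≠ 0 → aK i ι ι' ≠ 0 → qK i ι' b' ≠ 0 → tdist1 Nf (ℓF b) (ℓF b') ≤ sF)
    -- the G-station's `D ∕ D*` numerals, the site–bond reading range `r′`, a fibre bound of `ℓF`
    {CgR CdC : ℝ} (hCgR0 : 0 ≤ CgR) (hCgR : ∀ bb, ∑ z, |gradK i bb z| ≤ CgR) (hCdC0 : 0 ≤ CdC) (hCdC : ∀ bb, ∑ z, |divK i z bb| ≤ CdC)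
    {r' : ℝ}
    (hℓG : ∀ bb z, gradK i bb z ≠ 0 → tdist1 Nf (ℓF bb) (ℓ' z) ≤ r') (hℓD : ∀ z bb, divK i z bb ≠ 0 → tdist1 Nf (ℓ' z) (ℓF bb) ≤ r')
    {mF : ℕ} (hfibF : ∀ y : UT Nf, (univ.filter fun p : FBondY i × (Fin N × Fin N) => ℓF p.1 = y).card ≤ mF)
    -- ROW 17's ONE CLAUSE, verbatim — the ONLY analytic input
    (hpd : PosDefTr (fun _ => (1 : ℝ)) (deltaAY i (parSymY i) (parBY i) (GpY i (parSymY i)) U₀)) :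
    ∃ κG : ℝ, 0 < κG ∧ ∃ BG : ℝ, 0 ≤ BG ∧ ∀ ρ'' : ℝ, 0 ≤ ρ'' → ρ'' < κG → ∃ R₁ : ℝ, 0 < R₁ ∧
      RawEntryLetters (fun a : Fin (d + 1) → Site (PV d ℓ i.m i.K hd hL) 0 → Matrix (Fin N) (Fin N) ℂ =>
          LinearMap.toMatrix
            ((Pi.basis fun _ : FBondY i => Matrix.stdBasis ℂ (Fin N) (Fin N)).reindex (Equiv.sigmaEquivProd (FBondY i) (Fin N × Fin N)))
            ((Pi.basis fun _ : FBondY i => Matrix.stdBasis ℂ (Fin N) (Fin N)).reindex (Equiv.sigmaEquivProd (FBondY i) (Fin N × Fin N)))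
            (GAY i (parSymY i) (parBY i) (GpY i (parSymY i)) (prodCfg U₀ η a)))
        (fun p : FBondY i × (Fin N × Fin N) => ℓF p.1) R₁ ρ'' BG := by
  classical
  -- `G′`'s letters on the class (module 79, record coordinates) at its located thin radius `R⋆ = Rc / (4T + 1)`, `T ≥ 0`
  have hGp := rawEntryLetters_toMatrix_GpY_parSymY_prodCfg_of_reg335_record i hG hC0 hC1 hreg η hRc hD hCavg0 hCavg ℓ' hs0 hℓ hℓa hκ0 hκ hfib hρ'0 hρ'
  have hT : 0 ≤ (1 * (((d : ℝ) + 1) *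
        (1 * Real.exp (|η| * Rc) * (1 * Real.exp (|η| * Rc) * 1 * (1 * Real.exp (|η| * Rc)) + 1) * (1 * Real.exp (|η| * Rc)) +
          (1 * Real.exp (|η| * Rc) * 1 * (1 * Real.exp (|η| * Rc)) + 1)) +
        Cavg * ((1 * Real.exp (|η| * Rc)) ^ D * 1 * (1 * Real.exp (|η| * Rc)) ^ D)) * Real.exp ((1 / (4 * ((d : ℝ) + 2)) * κr) * s)) *
        (1 * 1 * (16 * ((((ℓ + 1) ^ i.k : ℕ) : ℝ)) ^ 2 * Real.sqrt N)) *
        (m * B6.c0 1 (((1 / (4 * ((d : ℝ) + 2))) * κr - ρ') / 3) ^ ν) * (m * B6.c0 1 (((1 / (4 * ((d : ℝ) + 2))) * κr - ρ') / 3) ^ ν) :=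
    mul_nonneg (mul_nonneg (mul_nonneg
      (mul_nonneg (mul_nonneg zero_le_one (add_nonneg (by positivity) (mul_nonneg hCavg0 (by positivity)))) (Real.exp_pos _).le)
      (by positivity)) (mul_nonneg (Nat.cast_nonneg _) (pow_nonneg (B6RandomWalk.c0_nonneg 1 _) ν)))
      (mul_nonneg (Nat.cast_nonneg _) (pow_nonneg (B6RandomWalk.c0_nonneg 1 _) ν))
  -- the X⁻¹ knit (Theorem 3.2's content on the class, this seat's module) at a thin radius `0 < R′ ≤ R⋆`, rate `ρ_X`
  obtain ⟨R', hR'0, hR'le, hXi⟩ := rawEntryLetters_toMatrix_XinvY_parSymY_prodCfg_of_letters_located i hG hreg.1 η (thinRadius_pos hRc hT)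
    (thinRadius_le hRc.le hT) hDQ hDQs hCQ0 hCQ hCQs0 hCQs ℓ' ℓB hℓQ hℓQs hfib hfibB hGp hμ₁ hμ₁ρ hκX0 hκ4 hκm hρX0 hρXκ
  have hρX : ρX ≤ ρ' := by linarith
  exact exists_rawEntryLetters_toMatrix_GAY_recordV4_prodCfg_of_reg335_of_posDefTr_one i hG hC0 hC1 hreg η hRc hD hCavg0 hCavg ℓ' hs0 hℓ hℓa hκ0 hκ hfib
    hρ'0 hρ' hR'0 hR'le hDQ hDQs hCQsr0 hCQsr hCQc0 hCQc ℓB hℓQ hℓQs hρX0 hρX hXi hμ h2μ hc₀ hc₂0 hc₁ hc₂ hNb0 hNb hDa hDa' hcQ0 hcQs0 hca0 hcQ hcQs hca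
    ℓF hℓp hℓq hCgR0 hCgR hCdC0 hCdC hℓG hℓD hfibF hpd

end Literature.MathematicalPhysics.QuantumFieldTheory.Balaban1983to89.B13GreenSymLettersOfReg335Closed

end
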